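import Literature.NumberTheory.EllipticCurves.PlusMinusPAdicLFunction
import HarnessLib

/-!
# Sprung's ♯/♭ `p`-adic `L`-functions of a weight-two form at a good prime, via Mazur–Tate elements

F. Sprung, *On pairs of `p`-adic `L`-functions for weight-two modular forms*, Algebra & Number
Theory 11 (2017), no. 4, 885–928, doi:10.2140/ant.2017.11.885 (= arXiv:1601.00010) [Sprung2017],
constructs for a weight-two eigenform `f = ∑ aₙqⁿ` and a good prime `p` — with NO hypothesis on
`a_p` — two Iwasawa functions `L_p^♯(f,T), L_p^♭(f,T) ∈ Λ` such that the classical (Amice–Vélu /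
Višik / Mazur–Tate–Teitelbaum) `p`-adic `L`-functions of the two roots `α, β` of `X² − a_pX + p`
decompose as `(L_p(f,α,T), L_p(f,β,T)) = (L_p^♯(f,T), L_p^♭(f,T)) · 𝓛og_{α,β}(1+T)` (Thm. 1.12 =
"Theorem (maintheorem)"; unique when `p` is supersingular). For `a_p = 0` they are Pollack's
`L_p^±` (§3.1: "They directly generalize … the three functions `log_p^+`, `log_p^-·α`, `log_p^-·β`
from [pollack]"). The construction is by MAZUR–TATE ELEMENTS: with
`𝒞_i(1+T) = (a_p, 1; −Φ_{p^i}(1+T), 0)`, `Ã = (a_p, 1; −1, 0)` (§4, p. 16 of the arXiv text) and the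
queue sequence `(θ_n)_n` of Mazur–Tate elements (`π θ_n = a_p θ_{n−1} − ν θ_{n−2}`, Def. 1.7 /
Example 1.8), Cor. 4.4 reads "Let `(Θ_n)_n` be a queue sequence. Then
`(Θ_n, νΘ_{n−1}) = Υ_n 𝒞_1⋯𝒞_n Ã⁻¹` for some `Υ_n ∈ Λ_n^{⊕2}`", Cor. 4.5 rewrites the Riemann sums
of `(L_p(f,α), L_p(f,β))` through these `Υ_n`, and `(L^♯, L^♭)` is the limit of the `Υ_n` in
`Λ^{⊕2}/𝔐` with `𝔐 = 0` for supersingular `p` ("Proposition (yeah)", proof of Thm. 1.12); for an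
elliptic curve with `a_p ≢ 1 (mod p)` the functions are integral (Cor. 4.10 / Cor. 4.11, via
Thm. 4.9). This is the ♯/♭ analogue of Pollack 2003 Prop. 6.18 (`θ_n ≡ ω_n^± L^± (mod ω_n)`), which
the tree vendors as `pollack_exists_plusMinusPAdicLFunction` (`PlusMinusPAdicLFunction.lean`).

## What is vendored, and in which form (cell `b2b-bsdres`, X8 prover B; D-0014 named fact + vocabulary)

As for Pollack's theorem, the tree has no supersingular `L_p(f, α, T)` (`α ∉ ℚ_p`), so Thm. 1.12 is
vendored in the INTRINSIC Mazur–Tate form it is proved in (Cor. 4.4–4.5), which involves only tree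
objects: `mazurTateElement f p n = θ_n ∈ ℚ[T]` (canonical lift, variable `1 + T ↔ γ =
cyclotomicGenerator p = 1 + p`), `IsCongrModOmega p n θ ω L` ("`θ ≡ ω·L (mod ω_n)` in `Λ ⊗ ℚ_p`"),
`cyclotomicOmega p n = ω_n = (1+T)^{pⁿ} − 1`. Reading the FIRST column of the matrix identity of
Cor. 4.4 level by level: the first column `(u_n, v_n)ᵀ` of `M_n := 𝒞_1⋯𝒞_n Ã⁻¹ ∈ M₂(ℤ[T])` satisfies
`M_n = M_{n−1} · (Ã 𝒞_n Ã⁻¹)` with `Ã 𝒞_n Ã⁻¹ = (a_p, Φ_{pⁿ}(1+T); −1, 0)`, i.e.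
`(u_0, v_0) = (0, 1)` (`M_0 = Ã⁻¹ = (0, −1; 1, a_p)`), `(u_1, v_1) = (1, 0)` and
`x_n = a_p·x_{n−1} − Φ_{p^{n−1}}(1+T)·x_{n−2}` for `x ∈ {u, v}`, `n ≥ 2` — the polynomials
`sharpPoly ap p n = u_n`, `flatPoly ap p n = v_n` below — while the SECOND column of `M_n` is
`Φ_{pⁿ}(1+T)` times the first column of `M_{n−1}`, so that (since `ν : Λ_{n−1} → Λ_n` is
multiplication by `ω_n/ω_{n−1} = Φ_{pⁿ}(1+T)`) the second component of Cor. 4.4 at level `n` is the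
first component at level `n − 1` and carries no further information. Hence, for the limit pair:

  `θ_n(T) ≡ −( u_n(T)·L^♯(T) + v_n(T)·L^♭(T) )  (mod ω_n)`  for every `n ≥ 0`   (`IsSprungPair`).

THE SIGN. Sprung's modular symbol is `[a/m]⁺_f = (φ(f,a/m)+φ(f,−a/m))/(2Ω_f⁺)` with
`φ(f,r) = 2πi∫_{i∞}^{r} f` (§1, Thm. 1.1), so that `[0]⁺_f = L(f,1)/Ω_f⁺` as for the tree's
`ratPlusSymbol` (`[0]⁺ = L(f,1)/Ω⁺_f`); the overall sign `−1` above is the one that makes the pair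
satisfy Sprung's table of special values after Cor. 4.11, "`p` odd, `i = 0`:
`L_p^♯(f,0) = (−a_p² + 2a_p + p − 1)·L(f,1)/Ω_f⁺`, `L_p^♭(f,0) = (2 − a_p)·L(f,1)/Ω_f⁺`" (it is the sign
of `C⁻⁽ᴺ⁺¹⁾(−1, −1; β, α) = −Ã⁻¹(α^{−N}, β^{−N}; −α^{−(N+1)}, −β^{−(N+1)})` between Def. 3.1 of
`𝓛og_{α,β}` and Lemma 1.9), and it is ALSO the sign of the tree's Pollack fact: at `a_p = 0` one has
`u_{2k+1} = (−1)^k ω⁺_{2k+1}`, `u_{2k} = 0`, `v_{2k} = (−1)^k ω⁻_{2k}`, `v_{2k+1} = 0`, so that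
`IsSprungPair f p 0 L♯ L♭` is LITERALLY the pair of congruence clauses of
`pollack_exists_plusMinusPAdicLFunction` with `L⁺ = L♯`, `L⁻ = L♭`
(`θ_n ≡ (−1)^{⌊n/2⌋+1} ω_n^± L^± (mod ω_n)`). Both consistency statements — the special-value table
(the constant terms `L♯(0)`, `L♭(0)` from the level-`1` and level-`0` congruences and the Hecke
relation) and the equivalence with Pollack's congruences at `a_p = 0` — are PROVED in the companion
Summits file `Summits/BirchSwinnertonDyer/Rank1Residual/Supersingular/SprungConstantTerm.lean`
(cell placement rule: our theorems live under `Summits/`); this file holds only the vocabulary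
transcribing the construction and the named fact.

CONVENTIONS deliberately fixed here: (i) the cyclotomic variable is the tree's
(`γ = cyclotomicGenerator p = 1 + p` for odd `p`; Sprung fixes `γ = 1 + 2p`, §1.1 — his arguments use
only that `γ` topologically generates `Γ`); (ii) trivial tame character `ω⁰` only (the branches
`ωⁱ`, `i ≠ 0`, need twisted symbols the tree does not have — as in the Pollack file); (iii) `p` odd
(`N = n + 1`; for `p = 2` Sprung shifts to `N = n + 2`); (iv) periods: the tree's `[·]⁺_f` is
normalised by `Ω⁺_f` (`plusPeriod f`), Sprung's Thm. 1.12 by the `Ω_f^±` of his Thm. 1.1 and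
Cor. 4.10–4.11 by the Néron periods `Ω_E^±` of a strong Weil curve; at an odd SUPERSINGULAR prime
(`p ∣ a_p`, so `a_p ≢ 1 (mod p)`: Cor. 4.10's hypothesis; `E[p]` irreducible, Manin constant prime
to `p`) these differ by `p`-adic units, exactly the remark made for `pollack_exists_plusMinusPAdicLFunction`
— integrality, the congruences in `Λ ⊗ ℚ_p` and the Iwasawa invariants are unaffected.
NOT vendored: the matrix `𝓛og_{α,β}` and Thm. 1.12 in the form `(L_α, L_β) = (L♯, L♭)𝓛og` (no
supersingular `L_α` in the tree), the completed `L̂^{♯/♭}` and the functional equation (Thm. 1.2 /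
4.13), the `λ`-invariant formulas of Part 2, non-vanishing of `L♯`, `L♭` (a separate question for `a_p ≠ 0`, §4 after the table; in
analytic rank `0` it follows from the constant terms), `p = 2`.
READING NOTE (added 2026-08-28, doc-only; no declaration touched): the `a_p = 0`, trivial-tame-character
display of the functional equation, Cor. 4.14 (`L♯(T^ι) = σ(1+T)^{c+a}L♯`, `L♭(T^ι) = σ(1+T)^{c+b}L♭`,
`(p+1)a = −p`, `(p+1)b = −1`, i.e. WITH the unit factors `W^±` of §3.5), IS NOW VENDORED for odd `p` as
the named fact `cor414_sharpFlat_functionalEquation_apZero` of the sibling file `SharpFlatFunctionalEquation`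
(with the proved ideal-currency corollary `….span_eq`); its `p = 2` instance is the tree THEOREM
`Literature.Barriers.BirchSwinnertonDyer.subst_invOnePlusSubOne_eq_of_isSprungPair_two`. Thm. 1.2 / 4.13
(completed functions, all branches `ωⁱ`) remain NOT vendored.

## Contents

* `Chroma` (`sharp | flat`), `sprungSeq`, `sharpPoly = u_n`, `flatPoly = v_n` with their defining
  recursion lemmas; `chromaticL` (pick `L♯` or `L♭`), `chromaticConst p ap` (`−a_p²+2a_p+p−1`
  resp. `2 − a_p`, the table after Cor. 4.11);
* `IsSprungPair f p ap L♯ L♭` — the Mazur–Tate characterisation above (a predicate; nothing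
  asserted), so that statements can quantify over "Sprung's `(L♯, L♭)`" as
  `Summit.….IsPollackPair` does over Pollack's `(L⁺, L⁻)`;
* the NAMED FACT `thm112_exists_isSprungPair` (D-0014; nothing asserted, users take it as a
  hypothesis `h` and no `_holds` is expected): for `p` odd, `f` the newform of `E = W`
  (`IsNewformOf W f`), `E` with good SUPERSINGULAR reduction at `p` (`p ∣ a_p(E)`), there are
  `L♯, L♭ ∈ Λ = ℤ_p⟦T⟧` with `IsSprungPair f p (a_p(E)) L♯ L♭`. Its `a_p = 0` case is implied by
  Pollack's fact (PROVED in the companion file: `exists_isSprungPair_of_pollack`).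

Used by the cell `b2b-bsdres` (BSD rank `≤ 1` residual classes; class X8 = `p = 3` good
supersingular with `a_3 = ±3`, the only supersingular case with `a_p ≠ 0`): the census seat iw-2
reads `(μ, λ)` of THESE `L♯, L♭` (PARI Mazur–Tate data, `γ = 1 + p`), and the X8 files
(`Supersingular/SharpFlat*.lean`) so far carried `L^{♯/♭}` only as an abstract datum.

## References

* F. Sprung, Algebra Number Theory 11 (2017) 885–928: §1 (Thm. 1.1, Def. 1.7, Example 1.8,
  Lemma 1.9, Cor. 1.11, Thm. 1.12), §3.1 (Def. of `𝓛og_{α,β}`, Remark 3.1), §4 (Prop. 4.1 Tandem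
  Lemma, Obs. 4.2, Prop. 4.3, Cor. 4.4, Cor. 4.5, "Proposition (yeah)", proof of Thm. 1.12,
  Remark 4.7, Thm. 4.9, Cor. 4.10, Cor. 4.11 and the table of special values, 4.12)
  [Sprung2017] [corpus: paper:arxiv-1601.00010 p0009–p0010, p0012, p0016–p0017].
* F. Sprung, J. Number Theory 132 (2012) 1483–1506 (the ♯/♭ theory for elliptic curves; Def. 4.5,
  Thm. 6.12) [Sprung2012].
* R. Pollack, Duke Math. J. 118 (2003) 523–558, Prop. 6.18 [Pollack2003] (the case `a_p = 0`).
-/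

noncomputable section

open scoped MatrixGroups ModularForm

open CongruenceSubgroup Polynomial Literature.NumberTheory.EllipticCurves.ModularForms

namespace Literature.NumberTheory.EllipticCurves.Sprung2017

/-! ### The two "colours" ♯ / ♭ -/

/-- The two chromatic signs `♯` (sharp) and `♭` (flat) of Sprung's theory (Sprung 2017, §1:
"`L_p^♯(f,T)` and `L_p^♭(f,T)`"). [cite: Sprung2017, Thm. 1.12 (notation)] -/
inductive Chroma : Type
  | sharp : Chroma
  | flat : Chroma
  deriving DecidableEq, Inhabited

/-! ### The recursion polynomials `u_n = sharpPoly`, `v_n = flatPoly` -/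

/-- **Sprung's recursion** in `ℤ[T]`: `x_0, x_1` given, and for `n ≥ 2`
`x_n = a_p · x_{n−1} − Φ_{p^{n−1}}(1+T) · x_{n−2}` (`Φ_m` the `m`-th cyclotomic polynomial) — the
recursion `M_n = M_{n−1}·(a_p, Φ_{pⁿ}(1+T); −1, 0)` satisfied by the first column of
`M_n = 𝒞_1(1+T)⋯𝒞_n(1+T)·Ã⁻¹`, `𝒞_i = (a_p, 1; −Φ_{p^i}(1+T), 0)`, `Ã = (a_p, 1; −1, 0)` (Sprung 2017
§3.1 and §4; the three-term relation `π θ_n = a_p θ_{n−1} − ν θ_{n−2}` of Def. 1.7 in matrix form).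
[cite: Sprung2017, §4 Cor. 4.4 (the matrices 𝒞_i, Ã) and Def. 1.7] -/
def sprungSeq (ap : ℤ) (p : ℕ) (x₀ x₁ : ℤ[X]) : ℕ → ℤ[X]
  | 0 => x₀
  | 1 => x₁
  | n + 2 => C ap * sprungSeq ap p x₀ x₁ (n + 1) -
      (cyclotomic (p ^ (n + 1)) ℤ).comp (X + 1) * sprungSeq ap p x₀ x₁ n

/-- `u_n = sharpPoly ap p n ∈ ℤ[T]`: the coefficient of `L♯` at level `n`, i.e. the `(1,1)` entry of
`𝒞_1⋯𝒞_n Ã⁻¹`: `u_0 = 0`, `u_1 = 1`, `u_2 = a_p`, `u_3 = a_p² − Φ_{p²}(1+T)`, … ; at `a_p = 0`,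
`u_{2k+1} = (−1)^k ω⁺_{2k+1}` and `u_{2k} = 0`. [cite: Sprung2017, §4 Cor. 4.4] -/
def sharpPoly (ap : ℤ) (p : ℕ) : ℕ → ℤ[X] :=
  sprungSeq ap p 0 1

/-- `v_n = flatPoly ap p n ∈ ℤ[T]`: the coefficient of `L♭` at level `n`, i.e. the `(2,1)` entry of
`𝒞_1⋯𝒞_n Ã⁻¹`: `v_0 = 1`, `v_1 = 0`, `v_2 = −Φ_p(1+T)`, `v_3 = −a_p Φ_p(1+T)`, … ; at `a_p = 0`,
`v_{2k} = (−1)^k ω⁻_{2k}` and `v_{2k+1} = 0`. [cite: Sprung2017, §4 Cor. 4.4] -/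
def flatPoly (ap : ℤ) (p : ℕ) : ℕ → ℤ[X] :=
  sprungSeq ap p 1 0

section Recursion

variable (ap : ℤ) (p : ℕ) (x₀ x₁ : ℤ[X])

/-- `x_0`. [cite: Sprung2017, §4 Cor. 4.4] -/
@[simp] theorem sprungSeq_zero : sprungSeq ap p x₀ x₁ 0 = x₀ := rfl

/-- `x_1`. [cite: Sprung2017, §4 Cor. 4.4] -/
@[simp] theorem sprungSeq_one : sprungSeq ap p x₀ x₁ 1 = x₁ := rfl

/-- `x_{n+2} = a_p x_{n+1} − Φ_{p^{n+1}}(1+T) x_n`. [cite: Sprung2017, §4 Cor. 4.4] -/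
theorem sprungSeq_add_two (n : ℕ) :
    sprungSeq ap p x₀ x₁ (n + 2) = C ap * sprungSeq ap p x₀ x₁ (n + 1) -
      (cyclotomic (p ^ (n + 1)) ℤ).comp (X + 1) * sprungSeq ap p x₀ x₁ n := rfl

/-- `u_0 = 0`. [cite: Sprung2017, §4 Cor. 4.4] -/
@[simp] theorem sharpPoly_zero : sharpPoly ap p 0 = 0 := rfl

/-- `u_1 = 1`. [cite: Sprung2017, §4 Cor. 4.4] -/
@[simp] theorem sharpPoly_one : sharpPoly ap p 1 = 1 := rfl

/-- `u_{n+2} = a_p u_{n+1} − Φ_{p^{n+1}}(1+T) u_n`. [cite: Sprung2017, §4 Cor. 4.4] -/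
theorem sharpPoly_add_two (n : ℕ) :
    sharpPoly ap p (n + 2) = C ap * sharpPoly ap p (n + 1) -
      (cyclotomic (p ^ (n + 1)) ℤ).comp (X + 1) * sharpPoly ap p n := rfl

/-- `v_0 = 1`. [cite: Sprung2017, §4 Cor. 4.4] -/
@[simp] theorem flatPoly_zero : flatPoly ap p 0 = 1 := rfl

/-- `v_1 = 0`. [cite: Sprung2017, §4 Cor. 4.4] -/
@[simp] theorem flatPoly_one : flatPoly ap p 1 = 0 := rfl

/-- `v_{n+2} = a_p v_{n+1} − Φ_{p^{n+1}}(1+T) v_n`. [cite: Sprung2017, §4 Cor. 4.4] -/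
theorem flatPoly_add_two (n : ℕ) :
    flatPoly ap p (n + 2) = C ap * flatPoly ap p (n + 1) -
      (cyclotomic (p ^ (n + 1)) ℤ).comp (X + 1) * flatPoly ap p n := rfl

/-- `u_2 = a_p`. [cite: Sprung2017, §4 Cor. 4.4] -/
theorem sharpPoly_two : sharpPoly ap p 2 = C ap := by
  rw [sharpPoly_add_two, sharpPoly_one, sharpPoly_zero, mul_one, mul_zero, sub_zero]

/-- `v_2 = −Φ_p(1+T)`. [cite: Sprung2017, §4 Cor. 4.4] -/
theorem flatPoly_two : flatPoly ap p 2 = -(cyclotomic (p ^ 1) ℤ).comp (X + 1) := by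
  rw [flatPoly_add_two, flatPoly_one, flatPoly_zero, mul_zero, mul_one, zero_sub]

end Recursion

/-! ### The Mazur–Tate characterisation of `(L♯, L♭)` -/

section Pair

variable {N : ℕ} (f : CuspForm (Gamma0 N) 2) (p : ℕ) [Fact p.Prime]

/-- The ring map `ℤ[T] → Λ = ℤ_p⟦T⟧` (coefficients `ℤ → ℤ_p`, polynomial ↦ power series), in
the form used by `IsCongrModOmega` (`u ↦ ((u.map (Int.castRingHom ℤ_[p]) : ℤ_[p][T]) : ℤ_p⟦T⟧)`).
[folklore] -/
def toIwasawa : ℤ[X] →+* IwasawaAlgebra p :=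
  (Polynomial.coeToPowerSeries.ringHom (R := ℤ_[p])).comp (Polynomial.mapRingHom (Int.castRingHom ℤ_[p]))


/-- **`(L♯, L♭)` is a Sprung pair for `f` at `p` (trace `a_p = ap`)** — the MAZUR–TATE
CHARACTERISATION of Sprung's ♯/♭ `p`-adic `L`-functions (Sprung 2017 Cor. 4.4–4.5 with Thm. 1.12,
read on the first column of `𝒞_1⋯𝒞_n Ã⁻¹`, see the module docstring): for every level `n ≥ 0`,
`θ_n ≡ −(u_n · L♯ + v_n · L♭) (mod ω_n)` in `Λ ⊗ ℚ_p`, with `θ_n = mazurTateElement f p n` (Pollack's /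
Mazur–Tate's modular element, tree variable `1 + T ↔ 1 + p`), `u_n = sharpPoly ap p n`,
`v_n = flatPoly ap p n`, `ω_n = (1+T)^{pⁿ} − 1`, and "`≡ (mod ω_n)` in `Λ ⊗ ℚ_p`" the tree's
`IsCongrModOmega` (with the constant multiplier `ω = −1`). Levels `0` and `1` read `θ_0 ≡ −L♭ (mod T)`,
`θ_1 ≡ −L♯ (mod ω_1)`; at `a_p = 0` the clauses are Pollack's `θ_n ≡ (−1)^{⌊n/2⌋+1} ω_n^± L^±`
(`n` odd: `L⁺ = L♯`; `n` even: `L⁻ = L♭`). A predicate; nothing asserted.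
[cite: Sprung2017, Cor. 4.4, Cor. 4.5 and Thm. 1.12 (shape only; nothing asserted)] -/
def IsSprungPair (ap : ℤ) (Lsharp Lflat : IwasawaAlgebra p) : Prop :=
  ∀ n : ℕ, IsCongrModOmega p n (mazurTateElement f p n) (-1)
    (toIwasawa p (sharpPoly ap p n) * Lsharp + toIwasawa p (flatPoly ap p n) * Lflat)

/-- Unfolding lemma for `IsSprungPair`. [cite: Sprung2017, Cor. 4.4 (shape only; nothing asserted)] -/
theorem isSprungPair_iff (ap : ℤ) (Lsharp Lflat : IwasawaAlgebra p) :
    IsSprungPair f p ap Lsharp Lflat ↔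
      ∀ n : ℕ, IsCongrModOmega p n (mazurTateElement f p n) (-1)
        (toIwasawa p (sharpPoly ap p n) * Lsharp + toIwasawa p (flatPoly ap p n) * Lflat) :=
  Iff.rfl

variable {p}

/-- The chromatic `p`-adic `L`-function `L^•` of colour `• ∈ {♯, ♭}` picked out of a pair.
[cite: Sprung2017, Thm. 1.12 (notation)] -/
def chromaticL (c : Chroma) (Lsharp Lflat : IwasawaAlgebra p) : IwasawaAlgebra p :=
  match c with
  | .sharp => Lsharp
  | .flat => Lflat

/-- `chromaticL ♯ = L♯`. [cite: Sprung2017, Thm. 1.12 (notation)] -/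
@[simp] theorem chromaticL_sharp (Lsharp Lflat : IwasawaAlgebra p) :
    chromaticL .sharp Lsharp Lflat = Lsharp := rfl

/-- `chromaticL ♭ = L♭`. [cite: Sprung2017, Thm. 1.12 (notation)] -/
@[simp] theorem chromaticL_flat (Lsharp Lflat : IwasawaAlgebra p) :
    chromaticL .flat Lsharp Lflat = Lflat := rfl

end Pair

section Constants

variable (p : ℕ)

/-- **The interpolation constants at the trivial character** (Sprung 2017, table after Cor. 4.11,
row "`p` odd, `i = 0`"): `L_p^♯(f,0) = (−a_p² + 2a_p + p − 1)·L(f,1)/Ω_f⁺` and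
`L_p^♭(f,0) = (2 − a_p)·L(f,1)/Ω_f⁺`; so `c_♯ = −a_p² + 2a_p + p − 1`, `c_♭ = 2 − a_p` (at `a_p = 0`:
`p − 1` and `2`, Pollack / Kobayashi (3.6)). [cite: Sprung2017, Cor. 4.11 (table of special values)] -/
def chromaticConst (ap : ℤ) : Chroma → ℤ
  | .sharp => -ap ^ 2 + 2 * ap + p - 1
  | .flat => 2 - ap

/-- `c_♯ = −a_p² + 2a_p + p − 1`. [cite: Sprung2017, Cor. 4.11 (table of special values)] -/
@[simp] theorem chromaticConst_sharp (ap : ℤ) :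
    chromaticConst p ap .sharp = -ap ^ 2 + 2 * ap + p - 1 := rfl

/-- `c_♭ = 2 − a_p`. [cite: Sprung2017, Cor. 4.11 (table of special values)] -/
@[simp] theorem chromaticConst_flat (ap : ℤ) : chromaticConst p ap .flat = 2 - ap := rfl

end Constants

/-! ### Sprung's theorem (named fact) -/

section Fact

variable {W : WeierstrassCurve ℚ} [W.IsElliptic] [W.IsGloballyMinimal] {N : ℕ} [NeZero N]
  {f : CuspForm (Gamma0 N) 2} {p : ℕ} [Fact p.Prime]

/-- **Sprung 2017, Theorem 1.12 (supersingular case), in its Mazur–Tate form (Cor. 4.4–4.5,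
Cor. 4.10–4.11).** "Theorem 1.12. Fix a tame character `ωⁱ`. When `p` is supersingular, there is a
unique vector of two Iwasawa functions `(L̂_p^♯(f,ωⁱ,T), L̂_p^♭(f,ωⁱ,T)) ∈ Λ^{⊕2}` so that
`(L_p(f,α,ωⁱ,T), L_p(f,β,ωⁱ,T)) = (L̂_p^♯(f,ωⁱ,T), L̂_p^♭(f,ωⁱ,T)) 𝓛oĝ` … The analogous statements in
parts a and b with objects without the hats hold." — constructed as the limit of the vectors `Υ_n`
of "Corollary 4.4. Let `(Θ_n)_n` be a queue sequence. Then `(Θ_n, νΘ_{n−1}) = Υ_n 𝒞_1⋯𝒞_n Ã⁻¹` for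
some `Υ_n ∈ Λ_n^{⊕2}`" applied to the Mazur–Tate elements (Cor. 4.5; `𝔐 = 0` for supersingular `p`),
integral for an elliptic curve with `a_p ≢ 1 (mod p)` ("Corollary 4.10. When `a_p ≢ 1 mod p`,
`L_p^♯(E,ωⁱ,T)` and `L_p^♭(E,ωⁱ,T)` and their completions are in `Λ`"; Cor. 4.11).
Transcription (trivial tame character, `p` odd, tree conventions — see the module docstring for the
first-column reading, the sign and the period normalisation): for `p ≠ 2`, `f` the newform of
`E = W` (`IsNewformOf W f`), `E` with good reduction at `p` and `p ∣ a_p(E)` (good SUPERSINGULAR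
reduction; then `a_p ≢ 1 (mod p)`), there exist `L♯, L♭ ∈ Λ = ℤ_p⟦T⟧` with
`θ_n ≡ −(u_n L♯ + v_n L♭) (mod ω_n)` for all `n` (`IsSprungPair f p (a_p(E)) L♯ L♭`). At `a_p = 0`
this is implied by `pollack_exists_plusMinusPAdicLFunction` (proved in the companion Summits file).
Non-vanishing of `L♯`, `L♭` is NOT part of the statement (whether either function can vanish
identically for `a_p ≠ 0` is a separate question raised after the table in §4 of the source; in
analytic rank `0` non-vanishing follows from the constant terms). Nothing is asserted: users take `(h : thm112_exists_isSprungPair)`; no `_holds` is expected.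
[cite: Sprung2017, Thm. 1.12, Cor. 4.4, Cor. 4.5, Cor. 4.10 and Cor. 4.11] -/
def thm112_exists_isSprungPair : Prop :=
  ∀ (_ : p ≠ 2) (_ : IsNewformOf W f) (_ : W.HasGoodReductionAtPrime p)
    (_ : (p : ℤ) ∣ W.frobeniusTrace p),
    ∃ Lsharp Lflat : IwasawaAlgebra p, IsSprungPair f p (W.frobeniusTrace p) Lsharp Lflat

end Fact

end Literature.NumberTheory.EllipticCurves.Sprung2017

end
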